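import Summits.HubbardSuperconductivity.HubbardSuperconductivity.Theorems.BalabanIRBirComplexStableXYRCovarianceFRDGradient
import Literature.Analysis.Matrix.FiniteRangeDecompositionQuasi1DBounds
import HarnessLib

/-!
# Crux `BirComplexStableXYR` (stmt-HubbardSuperconductivity-14845): the smooth finite-range pieces of
# the reference covariance in the QUASI-ONE-DIMENSIONAL regime `L ≤ 2^N ≤ M`

Support file (prover seat 1, route BalabanIR), the anisotropic companion of
`…CovarianceFRDGradient.lean`.  There the volume-uniform gradient bounds
`|∇_l C^{(m)}_N(x,y)| ≤ K 2^{−N(k+1)}` of the power-`m` finite-range pieces of the Hessian `H` of `Q_c`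
are proved for the scales BELOW the spatial size, `2^N ≤ L, M`.  The crux quantifies over all even
`L ≤ M`, so the multiscale expansion must also cross the scales `L ≤ 2^N ≤ M` of the anisotropic
space-time torus `(ℤ/L)² × ℤ/M` (blueprint M4 / the planner's T3: "after the spatial extent is
exhausted the remaining field is the slice zero-mode chain, a 1-D real Gaussian with finite-range
increments").  This file PROVES the Gaussian half of that statement for the engine, from the tree's
`Literature/Analysis/Matrix/FiniteRangeDecompositionQuasi1D{Pointwise,,Bounds}.lean`:

* `cfrd_frdPiecePow_gradient_quasi1D_spatial`: for a list `l` of `k ≤ 2m − 2` unit steps containing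
  a SPATIAL step, `|∇_l C^{(m)}_N(x,y)| ≤ K₁(m,k,4c₀/Λ_c) · (L/2^N)^{2m} / L^{k+1}` — beyond the
  spatial size the scale-`N` fluctuation field is constant on each time slice up to `O((L/2^N)^{2m})`;
* `cfrd_frdPiecePow_gradient_quasi1D_temporal`: for a list of `k ≤ 2m − 2` TEMPORAL steps,
  `|∇_l C^{(m)}_N(x,y)| ≤ K₂(m,k,4c₀/Λ_c) · 2^N / ((2^N)^k L²)` — the one-dimensional scaling with the
  slice-averaging prefactor `1/L²` (`k = 2`: the variance of a temporal increment of the slice zero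
  mode is `O(1/(2^N L²))` per scale, summable over `N`);
* **`birHessian_covarianceFRD_quasi1D`** (registered stub of this seat on the crux item): the
  conjunction of the two displays for every admissible table, `L ≤ 2^N ≤ M`, `m`, `x, y`.

`K₁ = 27m(2π)^kπ^{2m+2}2^{k+4}/(4(16c₀')^{m+1})`, `K₂ = (27m(2π)^k/4)(1 + 5·2^{k+2}π^{2m+2}/(16c₀')^{m+1})`,
`c₀' = 4c₀/Λ_c`, `Λ_c = 2·normA c·r³`.  No definitions; sorry-free. [folklore]
-/

noncomputable section

namespace Summit.HubbardSuperconductivity.HubbardSuperconductivity.Theorems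

set_option linter.dupNamespace false -- summit = problem name (single-conjunct summit), D-0017

open scoped BigOperators Matrix ComplexConjugate
open Complex Summit.HubbardSuperconductivity.BirComplexStableXYNegative
open Literature.Probability.LatticeModels Literature.Analysis.Matrix Literature.Analysis.Fourier

section Quasi1D

variable {r : ℕ} {L M : ℕ} [NeZero L] [NeZero M]

-- The window linear form `a_{(s,n)}(j) = Σ_w n_w [sh s w = j]` (local abbreviation).
set_option quotPrecheck false in
local notation "aform[" L' "," M' "](" s "," n "," j ")" =>
  ∑ w, (((n w : ℤ) : ℝ) * (if sh L' M' s w = j then (1 : ℝ) else 0))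

-- The inline Hessian matrix of `Q_c` (local abbreviation).
set_option quotPrecheck false in
local notation "Hm[" c' "," L' "," M' "]" => (Matrix.of fun i j : Λ L' M' =>
  (-(∑ k : Λ L' M' × ↥((c' : Table _).support),
    (c' : Table _) k.2 * ((aform[L',M'](k.1, k.2.1, i) : ℝ) : ℂ)
      * ((aform[L',M'](k.1, k.2.1, j) : ℝ) : ℂ))).re)

-- the three unit steps of the space-time torus (local abbreviation; inline in statements)
set_option quotPrecheck false in
local notation "Evec[" L' "," M' "]" =>
  (![((![1, 0] : Literature.Probability.LatticeModels.TorusSite 2 L'), (0 : ZMod M')), (![0, 1], 0), (0, 1)]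
    : Fin 3 → Λ L' M')

/-- The side vector `(L, L, M)` is non-degenerate. [folklore] -/
theorem cfrd_sides_ne_zero (i : Fin 3) : ((![L, L, M] : Fin 3 → ℕ) i) ≠ 0 := by
  fin_cases i
  · exact NeZero.ne L
  · exact NeZero.ne L
  · exact NeZero.ne M

/-- **Quasi-1D gradient bound for the smooth covariance pieces, spatial differences**: for `l` a list
of `k ≤ 2m − 2` unit steps `±E_i` containing a spatial step and `L ≤ 2^N ≤ M`,
`|∇_l C^{(m)}_N(x,y)| ≤ K₁(m,k,4c₀/Λ_c) · (L/2^N)^{2m}/L^{k+1}`. [folklore] -/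
theorem cfrd_frdPiecePow_gradient_quasi1D_spatial (hr : 2 ≤ r) (c : Table r) {c₀ : ℝ} (hc₀ : 0 < c₀)
    (hN : c.sum (fun _ a => a) = 0)
    (hC : ∀ φ : W r → ℝ, c₀ * ∑ w, ∑ w', (1 - Real.cos (φ w - φ w')) ≤ (genF c φ).re)
    (m N : ℕ) (hLT : L ≤ 2 ^ N) (hTM : 2 ^ N ≤ M)
    (l : List (Λ L M)) (hl : ∀ g ∈ l, ∃ i : Fin 3, g = Evec[L,M] i ∨ g = -(Evec[L,M] i))
    (hspat : ∃ g ∈ l, g = Evec[L,M] 0 ∨ g = -(Evec[L,M] 0) ∨ g = Evec[L,M] 1 ∨ g = -(Evec[L,M] 1))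
    (hkm : l.length + 2 ≤ 2 * m) (x y : Λ L M) :
    |rowDiffs l (frdPiecePow ((4 / (2 * normA c * (r : ℝ) ^ 3)) • Hm[c,L,M]) m N) x y|
      ≤ 27 * m * (2 * Real.pi) ^ l.length * Real.pi ^ (2 * m + 2) * 2 ^ (l.length + 4)
          / (4 * (16 * (4 * c₀ / (2 * normA c * (r : ℝ) ^ 3))) ^ (m + 1))
          * ((L : ℝ) / 2 ^ N) ^ (2 * m) / (L : ℝ) ^ (l.length + 1) := by
  obtain ⟨hAherm, hAti, hApsd, hA4, hcoer⟩ := cfrd_scaled_facts (L := L) (M := M) hr c hc₀ hN hC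
  have hc₀' : 0 < 4 * c₀ / (2 * normA c * (r : ℝ) ^ 3) :=
    div_pos (by positivity) (cfrd_scale_pos hr c hc₀ hC)
  have h := abs_rowDiffs_frdPiecePow_apply_le_quasi1D_spatial (Evec[L,M]) (![L, L, M])
    (fun i => cfrd_sides_ne_zero i) (fun i => cfrd_order i) (fun ψ φ h => cfrd_addChar_ext ψ φ h)
    cfrd_card rfl hAti hAherm hApsd hA4 hc₀' hcoer m N (by simpa using hLT) (by simpa using hTM)
    l hl hspat hkm x y
  simpa using h

/-- **Quasi-1D gradient bound for the smooth covariance pieces, temporal differences**: for `l` a list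
of `k ≤ 2m − 2` temporal unit steps `±E₂` and `L ≤ 2^N ≤ M`,
`|∇_l C^{(m)}_N(x,y)| ≤ K₂(m,k,4c₀/Λ_c) · 2^N/((2^N)^k L²)`. [folklore] -/
theorem cfrd_frdPiecePow_gradient_quasi1D_temporal (hr : 2 ≤ r) (c : Table r) {c₀ : ℝ} (hc₀ : 0 < c₀)
    (hN : c.sum (fun _ a => a) = 0)
    (hC : ∀ φ : W r → ℝ, c₀ * ∑ w, ∑ w', (1 - Real.cos (φ w - φ w')) ≤ (genF c φ).re)
    (m N : ℕ) (hLT : L ≤ 2 ^ N) (hTM : 2 ^ N ≤ M)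
    (l : List (Λ L M)) (htemp : ∀ g ∈ l, g = Evec[L,M] 2 ∨ g = -(Evec[L,M] 2))
    (hkm : l.length + 2 ≤ 2 * m) (x y : Λ L M) :
    |rowDiffs l (frdPiecePow ((4 / (2 * normA c * (r : ℝ) ^ 3)) • Hm[c,L,M]) m N) x y|
      ≤ 27 * m * (2 * Real.pi) ^ l.length / 4
          * (1 + 5 * 2 ^ (l.length + 2) * Real.pi ^ (2 * m + 2)
              / (16 * (4 * c₀ / (2 * normA c * (r : ℝ) ^ 3))) ^ (m + 1))
          * 2 ^ N / (((2 : ℝ) ^ N) ^ l.length * (L : ℝ) ^ 2) := by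
  obtain ⟨hAherm, hAti, hApsd, hA4, hcoer⟩ := cfrd_scaled_facts (L := L) (M := M) hr c hc₀ hN hC
  have hc₀' : 0 < 4 * c₀ / (2 * normA c * (r : ℝ) ^ 3) :=
    div_pos (by positivity) (cfrd_scale_pos hr c hc₀ hC)
  have h := abs_rowDiffs_frdPiecePow_apply_le_quasi1D_temporal (Evec[L,M]) (![L, L, M])
    (fun i => cfrd_sides_ne_zero i) (fun i => cfrd_order i) (fun ψ φ h => cfrd_addChar_ext ψ φ h)
    cfrd_card rfl hAti hAherm hApsd hA4 hc₀' hcoer m N (by simpa using hLT) (by simpa using hTM)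
    l htemp hkm x y
  simpa using h

/-- **The smooth covariance pieces across the quasi-one-dimensional scales `L ≤ 2^N ≤ M`
(registered stub `birHessian_covarianceFRD_quasi1D` of prover seat 1 on crux 2R).** [folklore] -/
theorem birHessian_covarianceFRD_quasi1D : ∀ (r : ℕ) (c : Table r) (c₀ : ℝ), 2 ≤ r → 0 < c₀ → c.sum (fun _ a => a) = 0 → (∀ φ : W r → ℝ, c₀ * ∑ w, ∑ w', (1 - Real.cos (φ w - φ w')) ≤ (genF c φ).re) → ∀ (L M : ℕ) [NeZero L] [NeZero M] (m N : ℕ), L ≤ 2 ^ N → 2 ^ N ≤ M → (∀ (l : List (Λ L M)), (∀ g ∈ l, ∃ i : Fin 3, g = (![((![1, 0] : Literature.Probability.LatticeModels.TorusSite 2 L), (0 : ZMod M)), (![0, 1], 0), (0, 1)] : Fin 3 → Λ L M) i ∨ g = -((![((![1, 0] : Literature.Probability.LatticeModels.TorusSite 2 L), (0 : ZMod M)), (![0, 1], 0), (0, 1)] : Fin 3 → Λ L M) i)) → (∃ g ∈ l, g = (![((![1, 0] : Literature.Probability.LatticeModels.TorusSite 2 L), (0 : ZMod M)), (![0, 1],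 0), (0, 1)] : Fin 3 → Λ L M) 0 ∨ g = -((![((![1, 0] : Literature.Probability.LatticeModels.TorusSite 2 L), (0 : ZMod M)), (![0, 1], 0), (0, 1)] : Fin 3 → Λ L M) 0) ∨ g = (![((![1, 0] : Literature.Probability.LatticeModels.TorusSite 2 L), (0 : ZMod M)), (![0, 1], 0), (0, 1)] : Fin 3 → Λ L M) 1 ∨ g = -((![((![1, 0] : Literature.Probability.LatticeModels.TorusSite 2 L), (0 : ZMod M)), (![0, 1], 0), (0, 1)] : Fin 3 → Λ L M) 1)) → l.length + 2 ≤ 2 * m → ∀ x y : Λ L M, |Literature.Analysis.Fourier.rowDiffs l (Literature.Analysis.Matrix.frdPiecePow ((4 / (2 * normA c * (r : ℝ) ^ 3)) • (Matrix.of fun i j : Λ L M => (-(∑ k : Λ L M × ↥c.support, c k.2 * ((∑ w, ((k.2 : Freq r) w : ℝ) * (if sh L M k.1 w = i then (1 : ℝ) else 0) : ℝ) : ℂ) * ((∑ w, ((k.2 : Freq r) w : ℝ) * (if sh L M k.1 w = j then (1 : ℝ) else 0) : ℝ) : ℂ))).re)) m N) x y| ≤ 27 * m * (2 * Real.pi)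 ^ l.length * Real.pi ^ (2 * m + 2) * 2 ^ (l.length + 4) / (4 * (16 * (4 * c₀ / (2 * normA c * (r : ℝ) ^ 3))) ^ (m + 1)) * ((L : ℝ) / 2 ^ N) ^ (2 * m) / (L : ℝ) ^ (l.length + 1)) ∧ (∀ (l : List (Λ L M)), (∀ g ∈ l, g = (![((![1, 0] : Literature.Probability.LatticeModels.TorusSite 2 L), (0 : ZMod M)), (![0, 1], 0), (0, 1)] : Fin 3 → Λ L M) 2 ∨ g = -((![((![1, 0] : Literature.Probability.LatticeModels.TorusSite 2 L), (0 : ZMod M)), (![0, 1], 0), (0, 1)] : Fin 3 → Λ L M) 2)) → l.length + 2 ≤ 2 * m → ∀ x y : Λ L M, |Literature.Analysis.Fourier.rowDiffs l (Literature.Analysis.Matrix.frdPiecePow ((4 / (2 * normA c * (r : ℝ) ^ 3)) • (Matrix.of fun i j : Λ L M => (-(∑ k : Λ L M × ↥c.support, c k.2 * ((∑ w, ((k.2 : Freq r) w : ℝ) * (if sh L M k.1 w = i then (1 : ℝ) else 0) : ℝ) : ℂ) * ((∑ w, ((k.2 : Freq r) w : ℝ) * (if sh L M k.1 w = j then (1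 : ℝ) else 0) : ℝ) : ℂ))).re)) m N) x y| ≤ 27 * m * (2 * Real.pi) ^ l.length / 4 * (1 + 5 * 2 ^ (l.length + 2) * Real.pi ^ (2 * m + 2) / (16 * (4 * c₀ / (2 * normA c * (r : ℝ) ^ 3))) ^ (m + 1)) * 2 ^ N / (((2 : ℝ) ^ N) ^ l.length * (L : ℝ) ^ 2)) := by
  intro r c c₀ hr hc₀ hN hC L M _ _ m N hLT hTM
  exact ⟨fun l hl hspat hkm x y =>
      cfrd_frdPiecePow_gradient_quasi1D_spatial hr c hc₀ hN hC m N hLT hTM l hl hspat hkm x y,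
    fun l htemp hkm x y =>
      cfrd_frdPiecePow_gradient_quasi1D_temporal hr c hc₀ hN hC m N hLT hTM l htemp hkm x y⟩

end Quasi1D

end Summit.HubbardSuperconductivity.HubbardSuperconductivity.Theorems

end
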